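import Literature.AlgebraicGeometry.Hu2025.Statements.S03Pluecker.R101aPlatform
import Mathlib.Order.SymmDiff
import Mathlib.Data.Sigma.Lex
import HarnessLib

/-!
# Hu 2025 (arXiv:2507.21400v1) §3.4–§3.5 = PDF §3d–§3e, chunks p0019 l.63 – p0020 l.66 (PDF p.41 l.3 – p.43 l.35) — interface I-ORD (PARTITION-HU row 102a):
# Def 3.11 (`<_lex`, `<_invlex`), Def 3.12 (m-rank), Def 3.13/3.14 (the order `<_℘` = `<`), Def 3.15 (orders on disjoint unions),
# the §3.5 summary (the term bookkeeping `S_F`, `sgn(s)`, `(u_s, v_s)`, `u_F`, rank, the printed order on `𝓕`, `𝕀^{lt,0}`)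
# STATEMENTS-FIRST typing (rung M-Hu-min of LADDER-RESOLUTION, D-0089); imports the row-101a platform — DRAFT BODY by
# res-type-009 for whoever owns row 102 at the 08:00Z re-point (T9: the owner re-reads every locator)

**Status of the source (D-0012): UNREFEREED PREPRINT UNDER ADJUDICATION** ([Hu2025], lit key `paper:arxiv-2507.21400`, TeX
chunks of record; «PDF p.N l.a–b» read on `lit/res-lit-6/hu25/text/hu25_pNNN.txt`, PDF display numbers (3.k) next to the TeX
labels). Nothing is asserted; definitions are real, claims are `def … : Prop` `[claim: Hu2025, status: under-review]`.

## Reading / carrier notes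
* Def 3.11's orders compare two subsets `η, ζ ⊂ K` of the SAME cardinality written as increasing arrays. SORT-FREE equivalent
  used (so that the orders are decidable and `decide`/`simp` evaluate them): «the left most nonzero number in η − ζ is negative»
  ⇔ the least element of the symmetric difference `η ∆ ζ` lies in `η`; «the right most non-zero number … is negative» ⇔ the
  greatest element of `η ∆ ζ` lies in `ζ` (this is Mathlib's colexicographic order `Finset.Colex`). The printed «more
  explicitly» clauses (l.72–78, l.83–89 = PDF p.41 l.8–11, l.14–17) are exactly these for equal cardinalities. The PDF
  prints the second symbol as «<_rlex» (p.41 l.13, l.17, l.22) where the TeX chunk has `\invlex` («<_invlex»); same order.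
* Def 3.14's sentence «This order coincides with the order on 𝓕 described in (blocks of gov)» (chunk p0019 l.139–141) reads
  in the PDF (p.42 l.13) «… described in §2e.2»: the label resolves to §2e.2 «Blocks of governing relations» (chunk p0012
  l.78–98 ‹2.5.2›; PDF p.25 l.35–45), whose three bullets (p0012 l.92–98 = PDF p.25 l.42–45) define the linear order on 𝓕 that
  §3.5 (p0020 l.34–42 = PDF p.43 l.18–22) restates with four bullets; `SummaryLT` types that order and `C20L34` the
  coincidence claim.
* Def 3.12's m-rank is `ℤ`-valued (`−1` off `𝕀^lt`); `rkPrimary` (row 101a) is the rank of `F_{m,u}`.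
* §3.5 = PDF §3e (chunk p0020 l.5–66; PDF p.43) is a SUMMARY: the term bookkeeping `S_F`, `sgn(s)`, `(u_s, v_s)`, `s_F`, `u_F` of
  displays p0018 l.38–55 (PDF (3.14)/(3.15), p.37 l.40 – p.38 l.3) is read off row 101a's `primaryTerms` (leading term first = `s_F`); the four bullets l.36–42 define the printed total
  order on `𝓕` (`SummaryLT`, = the §2e.2 order, see above), which Def 3.14 l.139–141 says «coincides» with `<_℘` (claim `C20L34`).
-/

noncomputable section

namespace Literature.AlgebraicGeometry.Hu2025.Statements.S03Pluecker

open MvPolynomial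

universe v

/-! ## Def 3.11, chunk p0019 l.65–107 (PDF p.41 l.4–26): `<_lex`, `<_invlex` (PDF: `<_rlex`) -/

/-- **Definition 3.11, `<_lex`** (chunk p0019 l.65–79; PDF p.41 l.4–12): «Let K be any fixed totally ordered finite set … Consider any two
subsets η ⊂ K and ζ ⊂ K with the cardinality n … We say η <_lex ζ if the left most nonzero number in the vector η − ζ is
negative, or more explicitly, if we can express η = {t₁ < ⋯ < t_{r−1} < s_r < ⋯}, ζ = {t₁ < ⋯ < t_{r−1} < t_r < ⋯} such that
s_r < t_r for some integer r ≥ 1.» SORT-FREE equivalent (module docstring): the least element of `η ∆ ζ` lies in `η`. PRINTED ONLY for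
subsets of EQUAL cardinality (there the two forms agree); typed on all pairs of finsets (junk off equal cardinality — within `WpLT`, equal
`m`-rank forces equal `|u ∖ m|`). [claim: Hu2025, status: under-review]
STATUS: candidate statement under adjudication (D-0012/D-0089); not asserted. -/
def LexLT {K : Type v} [LinearOrder K] (η ζ : Finset K) : Prop :=
  ∃ h : (symmDiff η ζ).Nonempty, (symmDiff η ζ).min' h ∈ η

/-- **Definition 3.11, `<_invlex`** (chunk p0019 l.81–91; PDF p.41 l.13–18, where the symbol is printed «<_rlex»): «we say
η <_invlex ζ if the right most non-zero number in the
vector η − ζ is negative, or more explicitly, … η = {⋯ < s_r < t_{r+1} < ⋯ < t_n}, ζ = {⋯ < t_r < t_{r+1} < ⋯ < t_n} such that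
s_r < t_r … the reverse lexicographic order induced by (K, <)». SORT-FREE equivalent: the greatest element of `η ∆ ζ` lies in
`ζ` (Mathlib's colexicographic order `Finset.Colex`). PRINTED ONLY for equal cardinalities; typed on all pairs (as `LexLT`).
[claim: Hu2025, status: under-review]
STATUS: candidate statement under adjudication (D-0012/D-0089); not asserted. -/
def InvLexLT {K : Type v} [LinearOrder K] (η ζ : Finset K) : Prop :=
  ∃ h : (symmDiff η ζ).Nonempty, (symmDiff η ζ).max' h ∈ ζ

/-- Numbered alias **`Def3_11`** = `LexLT` (Definition 3.11, PDF p.41 l.4–18, introduces both `<_lex` = `LexLT` and `<_invlex`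
(PDF «<_rlex») = `InvLexLT`; the alias names the first). [claim: Hu2025, status: under-review]
STATUS: candidate statement under adjudication (D-0012/D-0089); not asserted. -/
abbrev Def3_11 {K : Type v} [LinearOrder K] (η ζ : Finset K) : Prop := LexLT η ζ

/-! ## Def 3.12–3.14, chunk p0019 l.109–156 (PDF p.41 l.27 – p.42 l.21): the m-rank and the order `<_℘` -/

/-- **Definition 3.12, the m-rank** (chunk p0019 l.109–112; PDF p.41 l.27–31): «For any u ∈ 𝕀^lt_{3,n}, we define the m-rank of u (resp. x_u)
to be the rank of its corresponding primary Plücker equation F_{m,u}. If u ∈ (𝕀_{3,n} ∖ m) ∖ 𝕀^lt_{3,n}, then we set rk(u) = −1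
(resp. rk(x_u) = −1).» (PDF: «rank (u) = −1 (resp. rank (x_u) = −1)»). `ℤ`-valued; `rkPrimary` is row 101a's rank of `F_{m,u}`. [claim: Hu2025, status: under-review]
STATUS: candidate statement under adjudication (D-0012/D-0089); not asserted. -/
def mRank (u : ℕ × ℕ × ℕ) : ℤ := if IsLt u then (rkPrimary u : ℤ) else -1

/-- Numbered alias **`Def3_12`** = `mRank`. [claim: Hu2025, status: under-review]
STATUS: candidate statement under adjudication (D-0012/D-0089); not asserted. -/
abbrev Def3_12 (u : ℕ × ℕ × ℕ) : ℤ := mRank u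

/-- **Definition 3.13, `u <_℘ v` on `𝕀_{3,n} ∖ m`** (chunk p0019 l.114–125; PDF p.42 l.3–8): «We say u <_℘ v if one of the following three
holds: • rank_m u < rank_m v; • rank_m u = rank_m v, u ∖ m <_lex v ∖ m; • rank_m u = rank_m v, u ∖ m = v ∖ m, and m ∩ u <_lex
m ∩ v.» (`u, v` regarded as subsets via `triSet`; typed on all triples, meant for `u, v ≠ m`.)
[claim: Hu2025, status: under-review]
STATUS: candidate statement under adjudication (D-0012/D-0089); not asserted. -/
def WpLT (u v : ℕ × ℕ × ℕ) : Prop :=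
  mRank u < mRank v ∨
    (mRank u = mRank v ∧ LexLT (triSet u \ mSet) (triSet v \ mSet)) ∨
    (mRank u = mRank v ∧ triSet u \ mSet = triSet v \ mSet ∧ LexLT (mSet ∩ triSet u) (mSet ∩ triSet v))

/-- Numbered alias **`Def3_13`** = `WpLT`. [claim: Hu2025, status: under-review]
STATUS: candidate statement under adjudication (D-0012/D-0089); not asserted. -/
abbrev Def3_13 (u v : ℕ × ℕ × ℕ) : Prop := WpLT u v

/-- **Definition 3.14** (chunk p0019 l.127–151; PDF p.42 l.9–18): «Consider any two Plücker variables x_u and x_v. We say x_u <_℘ x_v if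
u <_℘ v», and for distinct primary equations «F̄_{m,u} <_℘ F̄_{m,v} if u <_℘ v»; l.147–149 «when comparing two Plücker variables
… or two m-primary Plücker equations, we exclusively use <_℘ … we will simply write < for <_℘». Typed on the variable indices
`plVar n`. [claim: Hu2025, status: under-review]
STATUS: candidate statement under adjudication (D-0012/D-0089); not asserted. -/
def Def3_14 {n : ℕ} (x y : plVar n) : Prop := WpLT x.1 y.1

/-- **Unnumbered claim C19L143** (chunk p0019 l.143–145; PDF p.42 l.14–15: «Under the above order, we can write 𝓕_m = {F̄_1 <_℘ ⋯
<_℘ F̄_Υ}»; also (p0020 l.45–49 = PDF (3.17), p.43 l.24–26) «we list all the above primary Plücker relations as F̄_1 < F̄_2 < ⋯ < F̄_Υ»): `<_℘` is a STRICT TOTAL order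
on `𝕀^lt_{3,n}`. [claim: Hu2025, status: under-review]
STATUS: candidate statement under adjudication (D-0012/D-0089); not asserted. -/
def C19L143 (n : ℕ) : Prop :=
  IsStrictTotalOrder {u : plIndex n // IsLt u.1} fun a b => WpLT a.1.1 b.1.1

/-! ## Def 3.15, chunk p0019 l.158 – p0020 l.3 (PDF p.42 l.22–30): orders on disjoint unions -/

/-- **Definition 3.15** (chunk p0019 l.160–166 and p0020 l.1–3; PDF p.42 l.23–30): «Let 𝔗_i be a finite set for all i ∈ [h] … the order
𝔗_1 < ⋯ < 𝔗_h naturally induces a partial order on the disjoint union ⊔_{i ∈ [h]} 𝔗_i as follows. Take any i < j ∈ [h],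
a_i ∈ 𝔗_i, and a_j ∈ 𝔗_j. Then, we say a_i < a_j.» and «If every 𝔗_i comes equipped with a total order … the disjoint union
⊔ 𝔗_i is totally ordered.» Typed as the lexicographic order on the sigma type — block index first, then the given order inside a
block (Mathlib `Sigma.Lex`); with `r i = ∅` it is the printed partial order. [claim: Hu2025, status: under-review]
STATUS: candidate statement under adjudication (D-0012/D-0089); not asserted. -/
def Def3_15 {h : ℕ} (T : Fin h → Type v) (r : ∀ i, T i → T i → Prop) : (Σ i, T i) → (Σ i, T i) → Prop :=
  Sigma.Lex (· < ·) r

/-! ## §3.5 (PDF §3e) summary, chunk p0020 l.5–66 (PDF p.43): term bookkeeping and the printed order on `𝓕` -/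

/-- **`S_F`, the index set of the terms of `F = F_{m,u}`** (displays p0016 l.126–131 = PDF eq. (3.4), p.34 l.9–17 «F = Σ_{s ∈ S_F} sgn(s)
p_{u_s}p_{v_s} for some index set S_F» and p0018 l.38–44 = PDF eq. (3.14), p.37 l.40–49; §3.5): the positions of row 101a's term list `primaryTerms u` (leading term `s_F` =
position `0`). PARTITION name `C20L5_SF`. [claim: Hu2025, status: under-review]
STATUS: candidate statement under adjudication (D-0012/D-0089); not asserted. -/
abbrev C20L5_SF (u : ℕ × ℕ × ℕ) : Type := Fin (primaryTerms u).length

/-- **`sgn(s)`**, «the ± sign associated with the quadratic monomial term p_{u_s}p_{v_s}» (p0016 l.130–131 = PDF p.34 l.15–17; p0018 l.38–44 = PDF (3.14)).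
[claim: Hu2025, status: under-review]
STATUS: candidate statement under adjudication (D-0012/D-0089); not asserted. -/
def sgnS (u : ℕ × ℕ × ℕ) (s : C20L5_SF u) : ℤ := ((primaryTerms u).get s).sgn

/-- **`(u_s, v_s)`**, the index pair of the term `s ∈ S_F` (p0016 l.130 = PDF p.34 l.15 «with u_s, v_s ∈ 𝕀_{3,n}»; for the leading term
`(u_{s_F}, v_{s_F}) = (u, m)`). [claim: Hu2025, status: under-review]
STATUS: candidate statement under adjudication (D-0012/D-0089); not asserted. -/
def indexUV (u : ℕ × ℕ × ℕ) (s : C20L5_SF u) : (ℕ × ℕ × ℕ) × (ℕ × ℕ × ℕ) :=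
  (((primaryTerms u).get s).us, ((primaryTerms u).get s).vs)

/-- **`u_F`**, the index of the leading variable «x_{u_F} := x_{u_{s_F}}» of `F̄ = F̄_{m,u}` (p0018 l.49–55 = PDF (3.15), p.37 l.52 – p.38 l.3): `u` itself.
[claim: Hu2025, status: under-review]
STATUS: candidate statement under adjudication (D-0012/D-0089); not asserted. -/
def uF (u : ℕ × ℕ × ℕ) : ℕ × ℕ × ℕ := u

/-- **rank of `F̄_{m,u}`** in the §3.5 summary (p0020 l.32 = PDF p.43 l.17 «The first three are of rank 0, the last is of rank 1») = row 101a's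
`rkPrimary`. [claim: Hu2025, status: under-review]
STATUS: candidate statement under adjudication (D-0012/D-0089); not asserted. -/
abbrev rankF (u : ℕ × ℕ × ℕ) : ℕ := rkPrimary u

/-- **The printed order on `𝓕`** of §2e.2 «Blocks of governing relations» (chunk p0012 l.92–98 ‹2.5.2›; PDF p.25 l.42–45: «The
set 𝓕 admits a linear order as follows. • F̄_{(123),iuv} < F_{(123),abc}; • F̄_{(123),iuv} < F̄_{(123),ju′v′} if (uvi) < (u′v′j)
lexicographically. • F̄_{(123),abc} < F̄_{(123),a′b′c′} if (abc) < (a′b′c′) lexicographically.») — the passage Def 3.14 refers to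
(«described in (blocks of gov)» = PDF «described in §2e.2», p.42 l.13) — restated in the §3.5 summary (chunk p0020 l.34–42; PDF
p.43 l.18–22: «• any relation of rank 0 is smaller than any relation of rank 1; • F̄_{(123),1uv} < F̄_{(123),2uv} < F̄_{(123),3uv};
• F̄_{(123),iuv} < F̄_{(123),ju′v′} if (uv) <_lex (u′v′), for any i, j ∈ [3]; • F̄_{(123),abc} < F̄_{(123),a′b′c′} if (abc) <_lex
(a′b′c′).»). Typed LITERALLY from the printed bullets on the SHAPES of the indices (an element of `𝕀^lt` is either `(i,a,b)` with `i ≤ 3 < a < b` — rank 0 — or `(a,b,c)` with `3 < a` — rank 1; the shape is read off `u.1 ≤ 3` vs `3 < u.1`): rank 0 before rank 1; rank 0 vs rank 0 by `(a,b) <_lex (a′,b′)`, ties broken by `i < j` (§2e.2 «(uvi) < (u′v′j)»); rank 1 vs rank 1 by `(abc) <_lex (a′b′c′)`. Meant for `u, v ∈ 𝕀^lt_{3,n}` (junk elsewhere). It is NOT defined through `WpLT`/`mRank`, so that `C20L34` carries the printed coincidence claim. [claim: Hu2025, status: under-review]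
STATUS: candidate statement under adjudication (D-0012/D-0089); not asserted. -/
def SummaryLT (u v : ℕ × ℕ × ℕ) : Prop :=
  -- bullet 1 (§3.5) / bullet 1 (§2e.2): any rank-0 relation `F̄_{(123),iuv}` (shape `i ≤ 3 < u < v`) is smaller than any
  -- rank-1 relation `F̄_{(123),abc}` (shape `3 < a < b < c`)
  (u.1 ≤ 3 ∧ 3 < v.1) ∨
  -- bullets 2–3 (§3.5) = bullet 2 (§2e.2) «(uvi) < (u′v′j) lexicographically»: two rank-0 relations `F̄_{iab} < F̄_{ja′b′}` iff
  -- `(a,b) <_lex (a′,b′)`, or `(a,b) = (a′,b′)` and `i < j`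
  (u.1 ≤ 3 ∧ v.1 ≤ 3 ∧
    ((u.2.1 < v.2.1 ∨ (u.2.1 = v.2.1 ∧ u.2.2 < v.2.2)) ∨ (u.2 = v.2 ∧ u.1 < v.1))) ∨
  -- bullet 4 (§3.5) = bullet 3 (§2e.2): two rank-1 relations `F̄_{abc} < F̄_{a′b′c′}` iff `(abc) <_lex (a′b′c′)`
  (3 < u.1 ∧ 3 < v.1 ∧
    (u.1 < v.1 ∨ (u.1 = v.1 ∧ (u.2.1 < v.2.1 ∨ (u.2.1 = v.2.1 ∧ u.2.2 < v.2.2)))))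

/-- **Unnumbered claim C20L34** (Def 3.14, chunk p0019 l.139–141; PDF p.42 l.13–14: «This order coincides with the order on 𝓕
described in (blocks of gov) [PDF: §2e.2]. The reader may consult with it since it is more concrete.»): on `𝕀^lt_{3,n}` the order
`<_℘` of Def 3.13 (`WpLT`) and the printed bullet order of §2e.2 / §3.5 (`SummaryLT`, typed literally on the index shapes) agree for all
`u, v ∈ 𝕀^lt_{3,n}` (a genuine combinatorial claim; no proof in print). [claim: Hu2025, status: under-review]
STATUS: candidate statement under adjudication (D-0012/D-0089); not asserted. -/
def C20L34 (n : ℕ) : Prop :=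
  ∀ u ∈ plIndexSet n, ∀ v ∈ plIndexSet n, IsLt u → IsLt v → (WpLT u v ↔ SummaryLT u v)

/-- **`𝕀^{lt,0}_{3,n}`** (display p0020 l.61–66 = PDF eq. (3.19), p.43 l.32–35): «𝕀^{lt,0}_{3,n} = {(1uv), (2uv), (3uv) ∣ 3 < u < v ≤ n}, the index set
for the leading terms of primary Plücker relations of rank-0». [claim: Hu2025, status: under-review]
STATUS: candidate statement under adjudication (D-0012/D-0089); not asserted. -/
def IsLt0 (u : ℕ × ℕ × ℕ) : Prop := IsLt u ∧ rkPrimary u = 0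

end Literature.AlgebraicGeometry.Hu2025.Statements.S03Pluecker

end
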